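import Summits.CriticalPhenomena.SAWScalingLimit.Theorems.SAWSpinMonotoneQCIdentificationNoBranchingAlgebra

/-!
# `NoBranching`, step S1 (continued) — darts, positive orientation and corner angles (helper of
`stub_noBranching : NoFoldBound → NoBranching`, line `eight_fifths_primitive`, crux `QCIdentification`,
stmt-CriticalPhenomena-16772)

**What.** For a mid-edge function `F` and a face (hexagonal-lattice vertex) `v` with counterclockwise
mid-edges `p_k = {v, hexNbr v k}`, the **darts** `dart F v k = (mid(p_k) - c(v)) · F(p_k)` are the three
side vectors of the image triangle of `v` under the PL developing map `H` (`dH` on the dual edges; `H`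
itself is never needed), and `cornerAngle F v k = π - arg (dart (k+1) / dart k)` are its corner angles.
For the critical observable `F = Fobs Λ a` of a simply connected domain with boundary source, at a
face with non-vanishing `∂H`-mode `S(v) = modeSum ≠ 0`, and under the no-fold bound (K)
(`NoFoldBound`), this file proves:

* `3 · dart_k = c₀(v) ω^k (S + ω^k B)` with the Beltrami mode `B = modeBel` (`three_mul_dart`; mode
  inversion + DCS Lemma 1 `L = 0` from the companion file `…NoBranchingAlgebra`);
* the **orientation identity** `Im(dart_{k+1} · conj dart_k) = (|c₀|²/9)(√3/2)(|S|² - |B|²)`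
  (`im_dart_mul_conj`, from the ring identity `orient_eq` modulo `ω³ = 1`, `conj ω = ω²`), hence, as
  (K) gives `|B| ≤ k|S| < |S|`, the image triangle is non-degenerate and positively oriented:
  all darts are non-zero (`dart_ne_zero`), `0 < arg (dart_{k+1}/dart_k) < π`
  (`arg_dart_div_pos`, `arg_dart_div_lt_pi`), i.e. every corner angle lies in `(0, π)`;
* the three turning angles sum to `2π` (`sum_arg_dart_div`: the three ratios multiply to `1`,
  arguments add in `Real.Angle`, and the real sum lies in `(0, 3π)`), so the **corner angles sum to
  `π`** (`sum_cornerAngle_eq_pi`).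

**Why.** This is the per-face input of the combinatorial Gauss–Bonnet count proving `NoBranching`
(local degree one of the developing map at every interior hexagon): corner angles in `(0, π)` summing
to `π` on every face of the source component, to be regrouped by lattice site. Registered entry points
(∀-telescopes, prefix `nb_`): `nb_dart_ne_zero`, `nb_cornerAngle_mem_Ioo`, `nb_sum_cornerAngle_eq_pi`.

Sources: H. Duminil-Copin, S. Smirnov, *The connective constant of the honeycomb lattice equals
`√(2+√2)`*, Ann. of Math. 175 (2012) 1653–1665 (arXiv:1007.0575), Lemma 1; the stub report
`STUB-REPORT-noBranching.md` of this line (§2, S1).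
-/

noncomputable section

open Complex
open scoped ComplexConjugate
open Literature.Probability.LatticeModels Literature.Probability.RandomPlanarGeometry.SAW
open Summit.CriticalPhenomena.SAWScalingLimit.Theses.SAWDevelopingMap

namespace Summit.CriticalPhenomena.SAWScalingLimit.Cruxes.QCIdentification.EightFifthsPrimitive

namespace NB

/-- The **dart** of a mid-edge function at the `k`-th mid-edge of `v`: `(mid(p_k) - c(v)) · F(p_k)`, the
side vector `dH` of the image triangle of the face `v` under the developing map. -/
def dart (F : Sym2 HexVertex → ℂ) (v : HexVertex) (k : Fin 3) : ℂ :=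
  (hexMidpoint s(v, hexNbr v k) - hexCenter v) * F s(v, hexNbr v k)

/-- The **corner angle** of the image triangle between the consecutive sides `dart k` and
`dart (k+1)`: `π - arg (dart (k+1) / dart k)`. -/
def cornerAngle (F : Sym2 HexVertex → ℂ) (v : HexVertex) (k : Fin 3) : ℝ :=
  Real.pi - Complex.arg (dart F v (k + 1) / dart F v k)

/-! ### The cube root of unity: `conj ω = ω²` -/

/-- `conj ω = ω²` (`ω` lies on the unit circle and `ω³ = 1`). -/
theorem conj_omg : conj omg = omg ^ 2 := by
  have h3 : Real.sqrt 3 * Real.sqrt 3 = 3 := Real.mul_self_sqrt (by norm_num)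
  rw [omg_eq]
  apply Complex.ext
  · simp only [Complex.conj_re, sq, Complex.mul_re]
    nlinarith [h3]
  · simp only [Complex.conj_im, sq, Complex.mul_im]
    ring

/-! ### The orientation identity `Im(ω^{k+1}(S + ω^{k+1}B) · conj(ω^k (S + ω^k B))) = (√3/2)(|S|² - |B|²)` -/

/-- Sesquilinear normal form of the orientation form (a ring identity modulo `ω³ = 1`,
`conj ω = ω²`). -/
theorem orient_eq (S B : ℂ) (k : Fin 3) :
    ∃ X : ℂ, omg ^ ((k : ℕ) + 1) * (S + omg ^ ((k : ℕ) + 1) * B) *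
        conj (omg ^ (k : ℕ) * (S + omg ^ (k : ℕ) * B)) =
      omg * (S * conj S) + omg ^ 2 * (B * conj B) + (X + conj X) := by
  fin_cases k
  · refine ⟨omg ^ 2 * B * conj S, ?_⟩
    simp only [map_mul, map_add, map_pow, conj_omg, Complex.conj_conj]
    linear_combination (-(omg * S * conj B)) * omg_pow_three
  · refine ⟨B * conj S, ?_⟩
    simp only [map_mul, map_add, map_pow, conj_omg, Complex.conj_conj]
    linear_combination (omg * S * conj S + (omg ^ 3 + 1) * (S * conj B + B * conj S) +
      omg ^ 2 * (omg ^ 3 + 1) * B * conj B) * omg_pow_three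
  · refine ⟨omg * B * conj S, ?_⟩
    simp only [map_mul, map_add, map_pow, conj_omg, Complex.conj_conj]
    linear_combination (omg * (omg ^ 3 + 1) * S * conj S +
      omg ^ 2 * (omg ^ 6 + omg ^ 3 + 1) * S * conj B + omg * (omg ^ 6 + omg ^ 3 + 1) * B * conj S +
      omg ^ 2 * (omg ^ 9 + omg ^ 6 + omg ^ 3 + 1) * B * conj B) * omg_pow_three

/-- **The orientation identity.** -/
theorem orient_im (S B : ℂ) (k : Fin 3) :
    (omg ^ ((k : ℕ) + 1) * (S + omg ^ ((k : ℕ) + 1) * B) *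
        conj (omg ^ (k : ℕ) * (S + omg ^ (k : ℕ) * B))).im =
      Real.sqrt 3 / 2 * (normSq S - normSq B) := by
  obtain ⟨X, hX⟩ := orient_eq S B k
  rw [hX, Complex.mul_conj, Complex.mul_conj, Complex.add_conj, omg_eq]
  simp only [Complex.add_im, Complex.mul_im, Complex.mul_re, sq, Complex.ofReal_re,
    Complex.ofReal_im, mul_zero, zero_add]
  ring

/-! ### Darts of the observable: `3 · dart_k = c₀ ω^k (S + ω^k B)` -/

/-- The **Beltrami mode** of a mid-edge function around a vertex (the clockwise labelling of (K)):
`B(v) = F(p₀) + ω F(p₂) + ω² F(p₁)`. -/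
def modeBel (F : Sym2 HexVertex → ℂ) (v : HexVertex) : ℂ :=
  F s(v, hexNbr v 0) + omg * F s(v, hexNbr v 2) + omg ^ 2 * F s(v, hexNbr v 1)

/-- `dart_k = c₀(v) ω^k F(p_k)`. -/
theorem dart_eq (F : Sym2 HexVertex → ℂ) (v : HexVertex) (k : Fin 3) :
    dart F v k = dartCoeff v * omg ^ (k : ℕ) * F s(v, hexNbr v k) := by
  rw [dart, hexMidpoint_sub_hexCenter]

/-- `ω^{k+1}` with the successor taken in `Fin 3` is `ω^{k+1}` with the successor taken in `ℕ`. -/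
theorem omg_pow_fin_succ (k : Fin 3) : omg ^ ((k + 1 : Fin 3) : ℕ) = omg ^ ((k : ℕ) + 1) := by
  fin_cases k
  · rfl
  · rfl
  · simpa using omg_pow_three.symm

variable {Λ : Finset HexVertex} {a : Sym2 HexVertex} {v : HexVertex}

/-- **Mode inversion under Lemma 1**: `3 F(p_k) = S(v) + ω^k B(v)`. -/
theorem three_mul_fobs (hΛ : hexDomainSimplyConnected Λ) (ha : a ∈ hexDomainBoundary Λ) (hv : v ∈ Λ)
    (k : Fin 3) :
    3 * Fobs Λ a s(v, hexNbr v k) = modeSum (Fobs Λ a) v + omg ^ (k : ℕ) * modeBel (Fobs Λ a) v := by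
  have hL := lemma1_mode hΛ ha hv
  rw [modeSum, modeBel]
  match k with
  | 0 =>
    simp only [Fin.val_zero, pow_zero, one_mul]
    linear_combination three_mul_eq₀ (Fobs Λ a s(v, hexNbr v 0)) (Fobs Λ a s(v, hexNbr v 1))
      (Fobs Λ a s(v, hexNbr v 2)) + hL
  | 1 =>
    simp only [Fin.val_one, pow_one]
    linear_combination three_mul_eq₁ (Fobs Λ a s(v, hexNbr v 0)) (Fobs Λ a s(v, hexNbr v 1))
      (Fobs Λ a s(v, hexNbr v 2)) + omg ^ 2 * hL
  | 2 =>
    simp only [Fin.val_two]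
    linear_combination three_mul_eq₂ (Fobs Λ a s(v, hexNbr v 0)) (Fobs Λ a s(v, hexNbr v 1))
      (Fobs Λ a s(v, hexNbr v 2)) + omg * hL

/-- **The darts in modes**: `3 · dart_k = c₀(v) · ω^k (S(v) + ω^k B(v))`. -/
theorem three_mul_dart (hΛ : hexDomainSimplyConnected Λ) (ha : a ∈ hexDomainBoundary Λ) (hv : v ∈ Λ)
    (k : Fin 3) :
    3 * dart (Fobs Λ a) v k =
      dartCoeff v * (omg ^ (k : ℕ) * (modeSum (Fobs Λ a) v + omg ^ (k : ℕ) * modeBel (Fobs Λ a) v)) := by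
  rw [dart_eq, ← three_mul_fobs hΛ ha hv k]
  ring

/-- **Orientation of the image triangle, exactly**:
`Im(dart_{k+1} · conj dart_k) = (|c₀|²/9)(√3/2)(|S|² - |B|²)`. -/
theorem im_dart_mul_conj (hΛ : hexDomainSimplyConnected Λ) (ha : a ∈ hexDomainBoundary Λ)
    (hv : v ∈ Λ) (k : Fin 3) :
    (dart (Fobs Λ a) v (k + 1) * conj (dart (Fobs Λ a) v k)).im =
      normSq (dartCoeff v) / 9 * (Real.sqrt 3 / 2) *
        (normSq (modeSum (Fobs Λ a) v) - normSq (modeBel (Fobs Λ a) v)) := by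
  have h9 : dart (Fobs Λ a) v (k + 1) * conj (dart (Fobs Λ a) v k) =
      ((1 / 9 : ℝ) : ℂ) * ((3 * dart (Fobs Λ a) v (k + 1)) * conj (3 * dart (Fobs Λ a) v k)) := by
    simp only [map_mul, map_ofNat]
    push_cast
    ring
  rw [h9, three_mul_dart hΛ ha hv (k + 1), three_mul_dart hΛ ha hv k, omg_pow_fin_succ,
    map_mul (starRingEnd ℂ) (dartCoeff v)]
  set S := modeSum (Fobs Λ a) v
  set B := modeBel (Fobs Λ a) v
  have hre : ((1 / 9 : ℝ) : ℂ) * (dartCoeff v * (omg ^ ((k : ℕ) + 1) * (S + omg ^ ((k : ℕ) + 1) * B)) *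
      ((starRingEnd ℂ) (dartCoeff v) * (starRingEnd ℂ) (omg ^ (k : ℕ) * (S + omg ^ (k : ℕ) * B)))) =
      ((1 / 9 * normSq (dartCoeff v) : ℝ) : ℂ) * (omg ^ ((k : ℕ) + 1) * (S + omg ^ ((k : ℕ) + 1) * B) *
        conj (omg ^ (k : ℕ) * (S + omg ^ (k : ℕ) * B))) := by
    rw [Complex.ofReal_mul, ← Complex.mul_conj]
    ring
  rw [hre, Complex.im_ofReal_mul, orient_im]
  ring

/-- **(K) at a non-degenerate face**: the Beltrami mode is strictly dominated, `|B|² < |S|²`. -/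
theorem normSq_modeBel_lt (hK : NoFoldBound) (hΛ : hexDomainSimplyConnected Λ)
    (ha : a ∈ hexDomainBoundary Λ) (hv : v ∈ Λ) (hS : modeSum (Fobs Λ a) v ≠ 0) :
    normSq (modeBel (Fobs Λ a) v) < normSq (modeSum (Fobs Λ a) v) := by
  obtain ⟨k, hk1, hk⟩ := hK
  have hB := hk Λ hΛ a ha v hv (hexNbr v 0) (hexNbr v 2) (hexNbr v 1) (adj_hexNbr v 0)
    (adj_hexNbr v 2) (adj_hexNbr v 1) (hexNbr_ne v (by decide)) (hexNbr_ne v (by decide))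
    (hexNbr_ne v (by decide))
  simp only at hB
  change ‖modeBel (Fobs Λ a) v‖ ≤
    k * ‖Fobs Λ a s(v, hexNbr v 0) + Fobs Λ a s(v, hexNbr v 2) + Fobs Λ a s(v, hexNbr v 1)‖ at hB
  have hperm : Fobs Λ a s(v, hexNbr v 0) + Fobs Λ a s(v, hexNbr v 2) + Fobs Λ a s(v, hexNbr v 1) =
      modeSum (Fobs Λ a) v := by
    rw [modeSum]
    ring
  rw [hperm] at hB
  have hpos : 0 < ‖modeSum (Fobs Λ a) v‖ := norm_pos_iff.2 hS
  have hlt : ‖modeBel (Fobs Λ a) v‖ < ‖modeSum (Fobs Λ a) v‖ := by nlinarith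
  rw [Complex.normSq_eq_norm_sq, Complex.normSq_eq_norm_sq]
  exact sq_lt_sq' (by linarith [norm_nonneg (modeBel (Fobs Λ a) v)]) hlt

/-- **Positive orientation**: `Im(dart_{k+1} · conj dart_k) > 0` at a non-degenerate face under (K). -/
theorem im_dart_mul_conj_pos (hK : NoFoldBound) (hΛ : hexDomainSimplyConnected Λ)
    (ha : a ∈ hexDomainBoundary Λ) (hv : v ∈ Λ) (hS : modeSum (Fobs Λ a) v ≠ 0) (k : Fin 3) :
    0 < (dart (Fobs Λ a) v (k + 1) * conj (dart (Fobs Λ a) v k)).im := by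
  rw [im_dart_mul_conj hΛ ha hv k]
  have hc : 0 < normSq (dartCoeff v) := Complex.normSq_pos.2 (dartCoeff_ne_zero v)
  have hlt := normSq_modeBel_lt hK hΛ ha hv hS
  have h3 : 0 < Real.sqrt 3 := Real.sqrt_pos.2 (by norm_num)
  exact mul_pos (mul_pos (div_pos hc (by norm_num)) (half_pos h3)) (sub_pos.2 hlt)

/-- **Non-degenerate faces have non-zero darts** under (K). -/
theorem dart_ne_zero (hK : NoFoldBound) (hΛ : hexDomainSimplyConnected Λ)
    (ha : a ∈ hexDomainBoundary Λ) (hv : v ∈ Λ) (hS : modeSum (Fobs Λ a) v ≠ 0) (k : Fin 3) :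
    dart (Fobs Λ a) v k ≠ 0 := by
  rw [dart_eq]
  exact mul_ne_zero (mul_ne_zero (dartCoeff_ne_zero v) (pow_ne_zero _ (Complex.exp_ne_zero _)))
    (fobs_ne_zero_of_modeSum_ne_zero hK hΛ ha hv hS k)

/-- The ratio of consecutive darts has positive imaginary part. -/
theorem im_dart_div_pos (hK : NoFoldBound) (hΛ : hexDomainSimplyConnected Λ)
    (ha : a ∈ hexDomainBoundary Λ) (hv : v ∈ Λ) (hS : modeSum (Fobs Λ a) v ≠ 0) (k : Fin 3) :
    0 < (dart (Fobs Λ a) v (k + 1) / dart (Fobs Λ a) v k).im := by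
  have hd : dart (Fobs Λ a) v k ≠ 0 := dart_ne_zero hK hΛ ha hv hS k
  rw [div_eq_mul_inv, Complex.inv_def, ← mul_assoc, Complex.im_mul_ofReal]
  exact mul_pos (im_dart_mul_conj_pos hK hΛ ha hv hS k) (inv_pos.2 (Complex.normSq_pos.2 hd))

/-- **The turning angle lies in `(0, π)`**, lower bound. -/
theorem arg_dart_div_pos (hK : NoFoldBound) (hΛ : hexDomainSimplyConnected Λ)
    (ha : a ∈ hexDomainBoundary Λ) (hv : v ∈ Λ) (hS : modeSum (Fobs Λ a) v ≠ 0) (k : Fin 3) :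
    0 < arg (dart (Fobs Λ a) v (k + 1) / dart (Fobs Λ a) v k) := by
  have him := im_dart_div_pos hK hΛ ha hv hS k
  rcases (Complex.arg_nonneg_iff.2 him.le).lt_or_eq with h | h
  · exact h
  · exact absurd (Complex.arg_eq_zero_iff.1 h.symm).2 him.ne'

/-- **The turning angle lies in `(0, π)`**, upper bound. -/
theorem arg_dart_div_lt_pi (hK : NoFoldBound) (hΛ : hexDomainSimplyConnected Λ)
    (ha : a ∈ hexDomainBoundary Λ) (hv : v ∈ Λ) (hS : modeSum (Fobs Λ a) v ≠ 0) (k : Fin 3) :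
    arg (dart (Fobs Λ a) v (k + 1) / dart (Fobs Λ a) v k) < Real.pi :=
  Complex.arg_lt_pi_iff.2 (Or.inr (im_dart_div_pos hK hΛ ha hv hS k).ne')

/-- **Corner angles are positive.** -/
theorem cornerAngle_pos (hK : NoFoldBound) (hΛ : hexDomainSimplyConnected Λ)
    (ha : a ∈ hexDomainBoundary Λ) (hv : v ∈ Λ) (hS : modeSum (Fobs Λ a) v ≠ 0) (k : Fin 3) :
    0 < cornerAngle (Fobs Λ a) v k :=
  sub_pos.2 (arg_dart_div_lt_pi hK hΛ ha hv hS k)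

/-- **Corner angles are `< π`.** -/
theorem cornerAngle_lt_pi (hK : NoFoldBound) (hΛ : hexDomainSimplyConnected Λ)
    (ha : a ∈ hexDomainBoundary Λ) (hv : v ∈ Λ) (hS : modeSum (Fobs Λ a) v ≠ 0) (k : Fin 3) :
    cornerAngle (Fobs Λ a) v k < Real.pi :=
  sub_lt_self _ (arg_dart_div_pos hK hΛ ha hv hS k)

/-- **The turning angles of the image triangle sum to `2π`** (the three ratios multiply to `1`, each
argument lies in `(0, π)`, and arguments add modulo `2π`). -/
theorem sum_arg_dart_div (hK : NoFoldBound) (hΛ : hexDomainSimplyConnected Λ)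
    (ha : a ∈ hexDomainBoundary Λ) (hv : v ∈ Λ) (hS : modeSum (Fobs Λ a) v ≠ 0) :
    ∑ k : Fin 3, arg (dart (Fobs Λ a) v (k + 1) / dart (Fobs Λ a) v k) = 2 * Real.pi := by
  have hne : ∀ k, dart (Fobs Λ a) v k ≠ 0 := dart_ne_zero hK hΛ ha hv hS
  have h0 := arg_dart_div_pos hK hΛ ha hv hS 0
  have h1 := arg_dart_div_pos hK hΛ ha hv hS 1
  have h2 := arg_dart_div_pos hK hΛ ha hv hS 2
  have l0 := arg_dart_div_lt_pi hK hΛ ha hv hS 0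
  have l1 := arg_dart_div_lt_pi hK hΛ ha hv hS 1
  have l2 := arg_dart_div_lt_pi hK hΛ ha hv hS 2
  set d := dart (Fobs Λ a) v with hd
  have e0 : ((0 : Fin 3) + 1) = 1 := rfl
  have e1 : ((1 : Fin 3) + 1) = 2 := rfl
  have e2 : ((2 : Fin 3) + 1) = 0 := rfl
  rw [Fin.sum_univ_three]
  simp only [e0, e1, e2] at h0 h1 h2 l0 l1 l2 ⊢
  have hq : ∀ i j : Fin 3, d i / d j ≠ 0 := fun i j => div_ne_zero (hne i) (hne j)
  have hprod : d 1 / d 0 * (d 2 / d 1) * (d 0 / d 2) = 1 := by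
    rw [div_mul_div_comm, div_mul_div_comm,
      div_eq_one_iff_eq (mul_ne_zero (mul_ne_zero (hne 0) (hne 1)) (hne 2))]
    ring
  have hang : ((arg (d 1 / d 0) + arg (d 2 / d 1) + arg (d 0 / d 2) : ℝ) : Real.Angle) =
      ((0 : ℝ) : Real.Angle) := by
    rw [Real.Angle.coe_add, Real.Angle.coe_add, ← Complex.arg_mul_coe_angle (hq 1 0) (hq 2 1),
      ← Complex.arg_mul_coe_angle (mul_ne_zero (hq 1 0) (hq 2 1)) (hq 0 2), hprod, Complex.arg_one]
  obtain ⟨n, hn⟩ := Real.Angle.angle_eq_iff_two_pi_dvd_sub.1 hang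
  rw [sub_zero] at hn
  have hπ := Real.pi_pos
  have hnpos : (0 : ℝ) < n := by
    by_contra h
    have : 2 * Real.pi * n ≤ 0 := mul_nonpos_of_nonneg_of_nonpos (by positivity) (not_lt.1 h)
    linarith
  have hnlt : (n : ℝ) < 2 := by
    by_contra h
    have : 2 * Real.pi * 2 ≤ 2 * Real.pi * n := mul_le_mul_of_nonneg_left (not_lt.1 h) (by positivity)
    linarith
  have hn1 : n = 1 := by
    have h₁ : (0 : ℤ) < n := by exact_mod_cast hnpos
    have h₂ : n < (2 : ℤ) := by exact_mod_cast hnlt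
    omega
  subst hn1
  rw [hn]
  simp

/-- **The corner angles of the image triangle sum to `π`.** -/
theorem sum_cornerAngle_eq_pi (hK : NoFoldBound) (hΛ : hexDomainSimplyConnected Λ)
    (ha : a ∈ hexDomainBoundary Λ) (hv : v ∈ Λ) (hS : modeSum (Fobs Λ a) v ≠ 0) :
    ∑ k : Fin 3, cornerAngle (Fobs Λ a) v k = Real.pi := by
  simp only [cornerAngle, Finset.sum_sub_distrib, Finset.sum_const, Finset.card_univ,
    Fintype.card_fin, sum_arg_dart_div hK hΛ ha hv hS]
  ring

/-! ### Registered entry points (∀-telescopes) -/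

/-- **Non-degenerate faces have non-zero darts (registered form).** -/
theorem nb_dart_ne_zero : NoFoldBound → ∀ {Λ : Finset HexVertex}, hexDomainSimplyConnected Λ → ∀ {a : Sym2 HexVertex}, a ∈ hexDomainBoundary Λ → ∀ {v : HexVertex}, v ∈ Λ → modeSum (Fobs Λ a) v ≠ 0 → ∀ k : Fin 3, dart (Fobs Λ a) v k ≠ 0 :=
  fun hK _ hΛ _ ha _ hv hS k => dart_ne_zero hK hΛ ha hv hS k

/-- **Corner angles lie in `(0, π)` (registered form).** -/
theorem nb_cornerAngle_mem_Ioo : NoFoldBound → ∀ {Λ : Finset HexVertex}, hexDomainSimplyConnected Λ → ∀ {a : Sym2 HexVertex}, a ∈ hexDomainBoundary Λ → ∀ {v : HexVertex}, v ∈ Λ → modeSum (Fobs Λ a) v ≠ 0 → ∀ k : Fin 3, cornerAngle (Fobs Λ a) v k ∈ Set.Ioo 0 Real.pi :=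
  fun hK _ hΛ _ ha _ hv hS k => ⟨cornerAngle_pos hK hΛ ha hv hS k, cornerAngle_lt_pi hK hΛ ha hv hS k⟩

/-- **Corner angles sum to `π` (registered form).** -/
theorem nb_sum_cornerAngle_eq_pi : NoFoldBound → ∀ {Λ : Finset HexVertex}, hexDomainSimplyConnected Λ → ∀ {a : Sym2 HexVertex}, a ∈ hexDomainBoundary Λ → ∀ {v : HexVertex}, v ∈ Λ → modeSum (Fobs Λ a) v ≠ 0 → ∑ k : Fin 3, cornerAngle (Fobs Λ a) v k = Real.pi :=
  fun hK _ hΛ _ ha _ hv hS => sum_cornerAngle_eq_pi hK hΛ ha hv hS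

end NB

end Summit.CriticalPhenomena.SAWScalingLimit.Cruxes.QCIdentification.EightFifthsPrimitive
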